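import Mathlib
import HarnessLib
import Summits.Ventures.LatticeQCDFlow.Scaling.EliminationFrontComponents
import Summits.Ventures.LatticeQCDFlow.Scaling.TorusIsoperimetry
import Literature.Probability.LatticeModels.TorusBipartite

/-!
# LatticeQCDFlow / Scaling — THE ELIMINATION-FRONT VOLUME LAW ON THE TORUS: every ordering of the
# sites of `(ℤ/L)^d` has a fill neighbourhood of size `≥ c_d·L^{d-1}` (a clique of the filled
# graph); `tw((ℤ/L)^d) ≥ c_d·L^{d-1}`

HONEST FRAMING: exact (Metropolis-corrected) sampling algorithms for lattice gauge theory;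
figures of merit are autocorrelation/cost numbers at stated couplings and volumes; no
continuum-physics claim.

Venture `LatticeQCDFlow` (cell pub-lqcd), topic `Scaling`, FANOUT row 30 (lean-1) — OUR WORK, file 4
of the AUTOREGRESSIVE-CONTEXT (ELIMINATION-FRONT) VOLUME LAW (THEORY-2.md §4 row T2-AF (b)/(d)).
Assembly of `Scaling/EliminationFrontComponents.lean` (for EVERY linear order the elimination width
is at least the isoperimetric constant of the balanced size range, and the front is a clique of
the filled graph) with `Scaling/TorusIsoperimetry.lean` (a vertex set of the torus with
`L^d/(8d) ≤ |A| ≤ L^d/2` has `≥ c_d·L^{d-1}` boundary vertices, `c_d = isoConst d (1/(8d))`), after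
the three facts about the nearest-neighbour torus graph `torusGraph d L` on
`TorusSite d L = Fin d → ZMod L` (`Literature.Probability.LatticeModels.LatticeGraph`) that the
assembly consumes: it is connected (the tree's `torusGraph_connected_of_proj`,
`Literature.Probability.LatticeModels.TorusBipartite`), every neighbourhood has at most `2d`
vertices (`ncard_neighborSet_torusGraph_le`), and it has `L^d` vertices.

* **`torus_le_elimWidth`** — for `d ≥ 2`, `L ≥ 2` and EVERY linear order `o` of the sites:
  `c_d·L^{d-1} ≤ elimWidth` — some site `v` has at least `c_d·L^{d-1}` higher fill-neighbours
  (vertices `w ≻ v` joined to `v` by a lattice path whose interior precedes `v`);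
* **`torus_exists_isClique_elimGraph`** — these form a CLIQUE of the filled graph: `≥ c_d L^{d-1}`
  sites pairwise joined by fill edges, `≥ ½ c_d L^{d-1}(c_d L^{d-1} - 1)` fill edges in all;
* **`torus_le_treewidth`** — `c_d·L^{d-1} ≤ tw((ℤ/L)^d)` (the tree had the UPPER bounds
  `treewidth_le_of_grid` and duality; this is the lower bound of the right order, cf. the classical
  `tw(L × L grid) = L`).
READING (THEORY-2.md §3.1, T2-AF): an exact autoregressive sampler of a Markov random field on the
periodic lattice — whatever the order in which it visits the sites, whatever masking or
architecture — has a site whose conditional law given the previously visited sites depends on at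
least `c_d·L^{d-1}` of them as soon as the target is FAITHFUL to the fill structure (no accidental
cancellation); the sequel `Scaling/StieltjesCholeskyFill.lean` proves faithfulness for every
Gaussian field with a Stieltjes (ferromagnetic) precision — the massive lattice free field — where
the conditional law is read off the Cholesky factor.  Constants: `c_2 = 1/32`, `c_3 = 1/192`,
`c_4 = 1/1536` (not optimised; the raster order shows the exponent `d-1` is sharp).  Elementary;
nothing is cited as a fact; no `def`, no `sorry`.
-/

namespace Summit.Ventures.LatticeQCDFlow.Theory2.Autoregressive

open Finset Function
open Literature.Probability.LatticeModels (TorusSite torusGraph torusGraph_adj_iff outerBoundary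
  mem_outerBoundary_iff torusGraph_connected_of_proj)
open Literature.Combinatorics.SimpleGraph

variable {d L : ℕ}

/-! ## 1. The torus graph: degrees `≤ 2d`, `L^d` vertices -/

/-- **Every neighbourhood of the torus graph has at most `2d` vertices** (`x ± e_μ`). [folklore] -/
theorem ncard_neighborSet_torusGraph_le (x : TorusSite d L) :
    ((torusGraph d L).neighborSet x).ncard ≤ 2 * d := by
  classical
  set f : Fin d × Bool → TorusSite d L := fun p =>
    if p.2 then x + Pi.single p.1 1 else x - Pi.single p.1 1 with hf
  have hsub : (torusGraph d L).neighborSet x ⊆ ↑(univ.image f) := by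
    intro y hy
    rw [SimpleGraph.mem_neighborSet, torusGraph_adj_iff] at hy
    rw [coe_image, coe_univ, Set.image_univ, Set.mem_range]
    rcases hy.2 with ⟨i, hi⟩ | ⟨i, hi⟩
    · exact ⟨(i, true), by simp [hf, hi]⟩
    · exact ⟨(i, false), by simp [hf, hi]⟩
  calc ((torusGraph d L).neighborSet x).ncard
      ≤ (↑(univ.image f) : Set (TorusSite d L)).ncard := Set.ncard_le_ncard hsub (Set.toFinite _)
    _ = (univ.image f).card := Set.ncard_coe_finset _
    _ ≤ (univ : Finset (Fin d × Bool)).card := card_image_le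
    _ = 2 * d := by simp [mul_comm]

/-- The torus has `L^d` sites. [folklore] -/
theorem card_torusSite [NeZero L] : Fintype.card (TorusSite d L) = L ^ d := by
  simp [Fintype.card_pi, ZMod.card]

/-! ## 2. The isoperimetric hypothesis on the balanced range -/

/-- The outer boundary of `EliminationFrontComponents` is the tree's `outerBoundary` (as sets).
[folklore] -/
theorem outer_eq_coe_outerBoundary [NeZero L] (A : Finset (TorusSite d L)) :
    outer (torusGraph d L) ↑A = ↑(outerBoundary (torusGraph d L) A) := by
  ext w
  simp only [outer, Set.mem_setOf_eq, mem_coe, mem_outerBoundary_iff]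
  exact ⟨fun ⟨h1, u, hu, huw⟩ => ⟨h1, u, hu, huw.symm⟩, fun ⟨h1, u, hu, huw⟩ => ⟨h1, u, hu, huw.symm⟩⟩

/-- **The balanced range is an intermediate-density range**: `L^d ≤ 4d|A| + 2` and `2|A| < L^d`
(`d ≥ 2`, `L ≥ 2`) give `L^d/(8d) ≤ |A| ≤ (1 - 1/(8d))·L^d`, hence `|∂A| ≥ c_d·L^{d-1}` with
`c_d = isoConst d (1/(8d))`. [folklore] -/
theorem torus_outer_ge_of_balanced [NeZero L] (hd : 2 ≤ d) (hL : 2 ≤ L) (A : Set (TorusSite d L))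
    (h₁ : Fintype.card (TorusSite d L) ≤ 2 * (2 * d) * A.ncard + 2)
    (h₂ : 2 * A.ncard < Fintype.card (TorusSite d L)) :
    isoConst d (1 / (8 * d)) * (L : ℝ) ^ (d - 1) ≤ ((outer (torusGraph d L) A).ncard : ℝ) := by
  classical
  set A' : Finset (TorusSite d L) := A.toFinset with hA'
  have hAA' : A = ↑A' := by simp [hA']
  have hn : A.ncard = A'.card := by rw [hAA', Set.ncard_coe_finset]
  rw [card_torusSite] at h₁ h₂
  rw [hn] at h₁ h₂
  rw [hAA', outer_eq_coe_outerBoundary, Set.ncard_coe_finset]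
  have hd' : (0 : ℝ) < d := by exact_mod_cast (show 0 < d by omega)
  have hLd : (4 : ℝ) ≤ (L : ℝ) ^ d := by
    have h4 : (4 : ℝ) = 2 ^ 2 := by norm_num
    rw [h4]
    exact (pow_le_pow_right₀ (by norm_num) hd).trans
      (pow_le_pow_left₀ (by norm_num) (by exact_mod_cast hL) d)
  have h₁' : ((L : ℝ) ^ d) ≤ 2 * (2 * d) * (A'.card : ℝ) + 2 := by exact_mod_cast h₁
  have h₂' : 2 * (A'.card : ℝ) < (L : ℝ) ^ d := by exact_mod_cast h₂
  refine torus_card_outerBoundary_ge hL (by omega) (by positivity) A' ?_ ?_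
  · -- `L^d/(8d) ≤ |A|`
    rw [div_mul_eq_mul_div, one_mul, div_le_iff₀ (by positivity)]
    nlinarith
  · -- `|A| ≤ (1 - 1/(8d)) L^d`
    have h8 : (1 : ℝ) / (8 * d) ≤ 1 / 2 := by
      rw [div_le_div_iff₀ (by positivity) (by norm_num)]
      have : (1 : ℝ) ≤ d := by exact_mod_cast (show 1 ≤ d by omega)
      nlinarith
    nlinarith

/-! ## 3. The law -/

/-- **THE ELIMINATION-FRONT VOLUME LAW ON THE TORUS.**  For `d ≥ 2`, `L ≥ 2` and EVERY linear order
`o` of the sites of `(ℤ/L)^d`, the elimination width is at least `c_d·L^{d-1}`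
(`c_d = isoConst d (1/(8d))`): some site has at least that many higher fill-neighbours. [folklore] -/
theorem torus_le_elimWidth [NeZero L] (hd : 2 ≤ d) (hL : 2 ≤ L) (o : LinearOrder (TorusSite d L)) :
    isoConst d (1 / (8 * d)) * (L : ℝ) ^ (d - 1) ≤
      (@elimWidth (TorusSite d L) o _ (torusGraph d L) : ℝ) := by
  letI : LinearOrder (TorusSite d L) := o
  set w : ℕ := ⌈isoConst d (1 / (8 * d)) * (L : ℝ) ^ (d - 1)⌉₊ with hw
  have h3 : 3 ≤ Fintype.card (TorusSite d L) := by
    rw [card_torusSite]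
    calc 3 ≤ 2 ^ 2 := by norm_num
      _ ≤ L ^ 2 := Nat.pow_le_pow_left hL 2
      _ ≤ L ^ d := Nat.pow_le_pow_right (by omega) hd
  have key : w ≤ elimWidth (torusGraph d L) :=
    le_elimWidth_of_isoperimetry (torusGraph_connected_of_proj d L) (2 * d) w
      ncard_neighborSet_torusGraph_le h3 fun A hA₁ hA₂ =>
        Nat.ceil_le.mpr (torus_outer_ge_of_balanced hd hL A hA₁ hA₂)
  have key' : (w : ℝ) ≤ (elimWidth (torusGraph d L) : ℝ) := by exact_mod_cast key
  exact (Nat.le_ceil _).trans key'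

/-- **THE FRONT IS A CLIQUE OF THE FILLED GRAPH**: for EVERY linear order of the sites of `(ℤ/L)^d`
(`d, L ≥ 2`) the elimination graph contains a clique on at least `c_d·L^{d-1}` sites — pairwise
joined by fill edges, `≥ ½·c_d L^{d-1}·(c_d L^{d-1} - 1)` fill edges among them. [folklore] -/
theorem torus_exists_isClique_elimGraph [NeZero L] (hd : 2 ≤ d) (hL : 2 ≤ L)
    (o : LinearOrder (TorusSite d L)) :
    ∃ K : Finset (TorusSite d L), isoConst d (1 / (8 * d)) * (L : ℝ) ^ (d - 1) ≤ (K.card : ℝ) ∧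
      (@elimGraph (TorusSite d L) o.toLT (torusGraph d L)).IsClique (K : Set (TorusSite d L)) := by
  letI : LinearOrder (TorusSite d L) := o
  set w : ℕ := ⌈isoConst d (1 / (8 * d)) * (L : ℝ) ^ (d - 1)⌉₊ with hw
  have h3 : 3 ≤ Fintype.card (TorusSite d L) := by
    rw [card_torusSite]
    calc 3 ≤ 2 ^ 2 := by norm_num
      _ ≤ L ^ 2 := Nat.pow_le_pow_left hL 2
      _ ≤ L ^ d := Nat.pow_le_pow_right (by omega) hd
  obtain ⟨K, hK, hKc⟩ := exists_isClique_elimGraph_of_isoperimetry (torusGraph_connected_of_proj d L)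
    (2 * d) w ncard_neighborSet_torusGraph_le h3 fun A hA₁ hA₂ =>
      Nat.ceil_le.mpr (torus_outer_ge_of_balanced hd hL A hA₁ hA₂)
  have hK' : (w : ℝ) ≤ (K.card : ℝ) := by exact_mod_cast hK
  exact ⟨K, (Nat.le_ceil _).trans hK', hKc⟩

/-- **TREEWIDTH OF THE TORUS FROM BELOW**: `c_d·L^{d-1} ≤ tw((ℤ/L)^d)` for `d, L ≥ 2`. [folklore] -/
theorem torus_le_treewidth [NeZero L] (hd : 2 ≤ d) (hL : 2 ≤ L) :
    isoConst d (1 / (8 * d)) * (L : ℝ) ^ (d - 1) ≤ (treewidth (torusGraph d L) : ℝ) := by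
  set w : ℕ := ⌈isoConst d (1 / (8 * d)) * (L : ℝ) ^ (d - 1)⌉₊ with hw
  have h3 : 3 ≤ Fintype.card (TorusSite d L) := by
    rw [card_torusSite]
    calc 3 ≤ 2 ^ 2 := by norm_num
      _ ≤ L ^ 2 := Nat.pow_le_pow_left hL 2
      _ ≤ L ^ d := Nat.pow_le_pow_right (by omega) hd
  have key : w ≤ treewidth (torusGraph d L) :=
    le_treewidth_of_isoperimetry (torusGraph_connected_of_proj d L) (2 * d) w
      ncard_neighborSet_torusGraph_le h3 fun A hA₁ hA₂ =>
        Nat.ceil_le.mpr (torus_outer_ge_of_balanced hd hL A hA₁ hA₂)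
  have key' : (w : ℝ) ≤ (treewidth (torusGraph d L) : ℝ) := by exact_mod_cast key
  exact (Nat.le_ceil _).trans key'

/-- The constants in the venture's dimensions: `c_2 = 1/32`, `c_3 = 1/192`, `c_4 = 1/1536`.
[folklore] -/
theorem isoConst_two_three_four :
    isoConst 2 (1 / (8 * 2)) = 1 / 32 ∧ isoConst 3 (1 / (8 * 3)) = 1 / 192 ∧
      isoConst 4 (1 / (8 * 4)) = 1 / 1536 := by
  refine ⟨?_, ?_, ?_⟩ <;> norm_num [isoConst]

end Summit.Ventures.LatticeQCDFlow.Theory2.Autoregressive
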